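import Summits.Parity.GeneralizedHardyLittlewood.Theorems.PolymathEpsThreeCeilingGridBoundHighRankActivity
import Literature.NumberTheory.Sieve.MaynardCollatzWielandt

/-!
# Route `PolymathEpsThreeCeiling`, crux `GridBoundHigh` (stmt-Parity-19069): the rank/activity weight family
# ALONG A FIBRE — reduction of the budget conjunct of `stub_cwCertsHigh` to a function of three real variables

Companion to `PolymathEpsThreeCeilingGridBoundHighRankActivity.lean` (p820451: the family `RankActivity.weight`,
its positivity and pointwise bound).  The third conjunct of the stub (unit fibre budgets) evaluates the weight at
`t = Fin.insertNth m u s` for an outer point `s : Fin 2 → ℝ`, `s ≥ 0`, `∑ s ≤ 1 - ε`, and `u ∈ (0, 1 + ε - ∑ s]`.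
Here we compute that value in closed form (`RankActivity.weight_insertNth`): with `s₀ = s 0`, `s₁ = s 1`,
`σ = u + s₀ + s₁`, the atom `u` is always active, the atom `s₀` is active iff `0 < s₀ ∧ u + s₁ ≤ 1 - ε`, the atom
`s₁` iff `0 < s₁ ∧ u + s₀ ≤ 1 - ε`, and the order indicators of `u` are `1[s₀ < u ∨ s₁ < u]`, `1[s₀ < u ∧ s₁ < u]`,
resp. `1[s_act < u]` — giving the explicit profile `RankActivity.fibreWeight ε Λ c αS d₁ d₀ β s₀ s₁ u`.  Consequently
(`RankActivity.budget_of_fibreWeight`) the budget conjunct of the stub for this family FOLLOWS from the purely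
real-variable hypothesis
`∀ s₀ s₁ ≥ 0, s₀ + s₁ ≤ 1 - ε → ∫⁻ u in Ioc 0 (1 + ε - (s₀ + s₁)), ofReal (fibreWeight … s₀ s₁ u)⁻¹ ≤ 1`,
in which no `Fin 3`, `insertNth` or activity bookkeeping is left (packaged with the other three conjuncts as
`RankActivity.cwCert_of_rankActivity`, whose conclusion is the body of the stub at `(ε, Λ)`): on each of the at most five sub-intervals cut out
by `u = s₀, s₁, 1 - ε - s₀, 1 - ε - s₁` the integrand is the reciprocal of an affine function of `u` whenever `β` is
constant and `c, αS, d₁, d₀` are affine on the relevant `σ`-range (prover hand census `CENSUS-19069-orderone.md`, §F3).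
Support lemmas for stmt-Parity-19069 only; no summit claim.  Standard axioms.
-/

noncomputable section

open Finset MeasureTheory Set

namespace Summit.Parity.GeneralizedHardyLittlewood.Theses.PolymathEpsThreeCeiling

namespace RankActivity

open Classical in
/-- The rank/activity weight of the fibre atom `u` over the outer point `(s₀, s₁)` in closed form
(module docstring); `σ = u + s₀ + s₁`. -/
def fibreWeight (ε Λ : ℝ) (c αS d₁ d₀ β : ℝ → ℝ) (s₀ s₁ u : ℝ) : ℝ :=
  if (0 < s₀ ∧ u + s₁ ≤ 1 - ε) ∧ (0 < s₁ ∧ u + s₀ ≤ 1 - ε) then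
    αS (u + s₀ + s₁) + β (u + s₀ + s₁) * u
      + d₁ (u + s₀ + s₁) * (if s₀ < u ∨ s₁ < u then 1 else 0)
      + d₀ (u + s₀ + s₁) * (if s₀ < u ∧ s₁ < u then 1 else 0)
  else if 0 < s₀ ∧ u + s₁ ≤ 1 - ε then
    (Λ - c (u + s₀ + s₁)) + (2 * c (u + s₀ + s₁) - Λ) * (if s₀ < u then 1 else 0)
  else if 0 < s₁ ∧ u + s₀ ≤ 1 - ε then
    (Λ - c (u + s₀ + s₁)) + (2 * c (u + s₀ + s₁) - Λ) * (if s₁ < u then 1 else 0)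
  else Λ

/-- **The weight along a fibre.**  For an outer point `s : Fin 2 → ℝ` with `∑ s ≤ 1 - ε` and a fibre atom
`u > 0` inserted at position `m`, the rank/activity weight of atom `m` is `fibreWeight … (s 0) (s 1) u`. -/
theorem weight_insertNth (ε Λ : ℝ) (c αS d₁ d₀ β : ℝ → ℝ) (m : Fin 3) {u : ℝ} (hu : 0 < u)
    {s : Fin 2 → ℝ} (hs : ∑ j, s j ≤ 1 - ε) :
    weight ε Λ c αS d₁ d₀ β m (Fin.insertNth (α := fun _ => ℝ) m u s) =
      fibreWeight ε Λ c αS d₁ d₀ β (s 0) (s 1) u := by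
  classical
  set t : Fin 3 → ℝ := Fin.insertNth (α := fun _ => ℝ) m u s with ht
  have htm : t m = u := by simp [ht]
  have htk : ∀ k : Fin 2, t (m.succAbove k) = s k := by intro k; simp [ht]
  have hs2 : ∑ j, s j = s 0 + s 1 := Fin.sum_univ_two s
  have hσ : ∑ i, t i = u + s 0 + s 1 := by
    rw [Fin.sum_univ_succAbove _ m, htm, Fin.sum_univ_two, htk, htk]; ring
  have herase : ∀ j : Fin 3, ∑ i ∈ univ.erase j, t i = (u + s 0 + s 1) - t j := by
    intro j
    have h := Literature.NumberTheory.Sieve.MaynardCW.sub_sum_erase_eq j t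
    rw [hσ] at h; linarith
  -- activity of the three atoms
  have hmA : m ∈ actSet ε t := by
    rw [mem_actSet, herase m, htm]; exact ⟨hu, by linarith⟩
  have h0A : m.succAbove 0 ∈ actSet ε t ↔ 0 < s 0 ∧ u + s 1 ≤ 1 - ε := by
    rw [mem_actSet, herase, htk]; constructor <;> rintro ⟨h1, h2⟩ <;> exact ⟨h1, by linarith⟩
  have h1A : m.succAbove 1 ∈ actSet ε t ↔ 0 < s 1 ∧ u + s 0 ≤ 1 - ε := by
    rw [mem_actSet, herase, htk]; constructor <;> rintro ⟨h1, h2⟩ <;> exact ⟨h1, by linarith⟩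
  -- the count of active atoms
  have hcard : (actSet ε t).card =
      1 + (if 0 < s 0 ∧ u + s 1 ≤ 1 - ε then 1 else 0) + (if 0 < s 1 ∧ u + s 0 ≤ 1 - ε then 1 else 0) := by
    have e : (actSet ε t).card = ∑ j, if j ∈ actSet ε t then 1 else 0 := by
      rw [← Finset.card_filter]; congr 1; ext j; simp
    rw [e, Fin.sum_univ_succAbove _ m, Fin.sum_univ_two, if_pos hmA, if_congr h0A rfl rfl,
      if_congr h1A rfl rfl]
    ring
  -- the order indicators of the fibre atom
  have hnotMin : notMinInd t m = if s 0 < u ∨ s 1 < u then 1 else 0 := by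
    unfold notMinInd
    refine if_congr ?_ rfl rfl
    rw [Fin.exists_iff_succAbove m, Fin.exists_fin_two, htm, htk, htk]
    simp only [ne_eq, not_true_eq_false, false_and, false_or, Fin.succAbove_ne, not_false_eq_true,
      true_and]
  have hmax : maxInd t m = if s 0 < u ∧ s 1 < u then 1 else 0 := by
    unfold maxInd
    refine if_congr ?_ rfl rfl
    rw [Fin.forall_iff_succAbove m, Fin.forall_fin_two, htm, htk, htk]
    simp only [ne_eq, not_true_eq_false, IsEmpty.forall_iff, Fin.succAbove_ne, not_false_eq_true,
      forall_const, true_and]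
  have htop : topInd ε t m =
      if ((0 < s 0 ∧ u + s 1 ≤ 1 - ε) → s 0 < u) ∧ ((0 < s 1 ∧ u + s 0 ≤ 1 - ε) → s 1 < u) then 1 else 0 := by
    unfold topInd
    refine if_congr ?_ rfl rfl
    rw [Fin.forall_iff_succAbove m, Fin.forall_fin_two, htm, htk, htk, h0A, h1A]
    simp only [ne_eq, not_true_eq_false, IsEmpty.forall_iff, Fin.succAbove_ne, not_false_eq_true,
      forall_const, true_and]
  -- case analysis on the activity of the two outer atoms
  unfold weight fibreWeight
  rw [hσ, htm, hnotMin, hmax, htop]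
  by_cases ha0 : 0 < s 0 ∧ u + s 1 ≤ 1 - ε <;> by_cases ha1 : 0 < s 1 ∧ u + s 0 ≤ 1 - ε <;>
    simp [hcard, ha0, ha1]

/-- **Budget reduction** (conjunct 3 of `stub_cwCertsHigh` for this family): the unit fibre budgets of the
rank/activity weights follow from the same inequality for the explicit profile `fibreWeight` over all outer
pairs `s₀, s₁ ≥ 0` with `s₀ + s₁ ≤ 1 - ε`. -/
theorem budget_of_fibreWeight {ε Λ : ℝ} {c αS d₁ d₀ β : ℝ → ℝ}
    (H : ∀ s₀ s₁ : ℝ, 0 ≤ s₀ → 0 ≤ s₁ → s₀ + s₁ ≤ 1 - ε →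
      ∫⁻ u in Ioc (0:ℝ) (1 + ε - (s₀ + s₁)),
        ENNReal.ofReal (fibreWeight ε Λ c αS d₁ d₀ β s₀ s₁ u)⁻¹ ≤ 1) :
    ∀ m (s : Fin 2 → ℝ), (∀ i, 0 ≤ s i) → ∑ i, s i ≤ 1 - ε →
      ∫⁻ u in Ioc (0:ℝ) (1 + ε - ∑ i, s i),
        ENNReal.ofReal (weight ε Λ c αS d₁ d₀ β m (Fin.insertNth m u s))⁻¹ ≤ 1 := by
  intro m s hs0 hs
  have hs2 : ∑ j, s j = s 0 + s 1 := Fin.sum_univ_two s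
  have h := H (s 0) (s 1) (hs0 0) (hs0 1) (by rw [← hs2]; exact hs)
  rw [hs2]
  refine le_of_eq_of_le (setLIntegral_congr_fun measurableSet_Ioc fun u hu => ?_) h
  rw [weight_insertNth ε Λ c αS d₁ d₀ β m hu.1 hs]

/-- **Assembly for one `ε`.**  A rank/activity parameter set `(Λ; c, αS, d₁, d₀, β)` with the algebraic side
conditions of `weight_pos` / `sum_indicator_weight_le`, measurable parameter functions, and the explicit fibre
budgets of `fibreWeight`, yields a Cauchy–Schwarz weight certificate at `(ε, Λ)` in the EXACT shape of the body of
`stub_cwCertsHigh` (there `ε = j/80`, `Λ = 2(80+j)/(81+j)`): the four conjuncts fed to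
`polymathFunctional_le_of_weights (n := 2)`. -/
theorem cwCert_of_rankActivity {ε Λ : ℝ} {c αS d₁ d₀ β : ℝ → ℝ} (hΛ : 0 < Λ)
    (hc : ∀ σ, Λ / 2 ≤ c σ) (hc' : ∀ σ, c σ < Λ) (hαS : ∀ σ, 0 ≤ αS σ) (hd₁ : ∀ σ, 0 ≤ d₁ σ)
    (hd₀ : ∀ σ, 0 ≤ d₀ σ) (hβ : ∀ σ, 0 < β σ) (hflat : ∀ σ, 3 * αS σ + β σ * σ + 2 * d₁ σ + d₀ σ ≤ Λ)
    (mc : Measurable c) (mαS : Measurable αS) (md₁ : Measurable d₁) (md₀ : Measurable d₀)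
    (mβ : Measurable β)
    (H : ∀ s₀ s₁ : ℝ, 0 ≤ s₀ → 0 ≤ s₁ → s₀ + s₁ ≤ 1 - ε →
      ∫⁻ u in Ioc (0:ℝ) (1 + ε - (s₀ + s₁)),
        ENNReal.ofReal (fibreWeight ε Λ c αS d₁ d₀ β s₀ s₁ u)⁻¹ ≤ 1) :
    ∃ w : Fin 3 → (Fin 3 → ℝ) → ℝ, (∀ m, Measurable (w m)) ∧
      (∀ m (t : Fin 3 → ℝ), 0 < t m → ∑ i ∈ univ.erase m, t i ≤ 1 - ε → 0 < w m t) ∧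
      (∀ m (s : Fin 2 → ℝ), (∀ i, 0 ≤ s i) → ∑ i, s i ≤ 1 - ε →
        ∫⁻ u in Ioc (0:ℝ) (1 + ε - ∑ i, s i), ENNReal.ofReal (w m (Fin.insertNth m u s))⁻¹ ≤ 1) ∧
      (∀ t : Fin 3 → ℝ, (∀ i, 0 ≤ t i) → ∑ i, t i ≤ 1 + ε →
        ∑ m, (if 0 < t m ∧ ∑ i ∈ univ.erase m, t i ≤ 1 - ε then w m t else 0) ≤ Λ) :=
  ⟨weight ε Λ c αS d₁ d₀ β, measurable_weight mc mαS md₁ md₀ mβ, weight_pos hΛ hc hc' hαS hd₁ hd₀ hβ,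
    budget_of_fibreWeight H, sum_indicator_weight_le hΛ.le hc hd₁ hd₀ hflat⟩

end RankActivity

end Summit.Parity.GeneralizedHardyLittlewood.Theses.PolymathEpsThreeCeiling

end
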